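import Mathlib
import HarnessLib
import Literature.Analysis.FluidPDE.KNSSSwirlSupNonpos
import Summits.NavierStokesRegularity.NavierStokesRegularity.Theorems.HalfSpaceWindowDoorCirculationCarryingRigiditySubSwirl

/-!
# Route `HalfSpaceWindowDoor`, crux `CirculationCarryingRigidity` (stmt-NavierStokesRegularity-25311) — the ONE-SIDED
# eddy-torque engine, part 3a: the slice identity and the TIME INEQUALITY for swirl SUBSOLUTION pairs

Line `eddy_torque` (LEAD ns-hsw-p1 g5).  KNSS (Acta Math. 203 (2009), proof of Thm 5.3, (5.15)–(5.19)) test the swirl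
equation against the cut-off `φ = ξ(r)η(z)ζ(s) ≥ 0`.  For a swirl SUBSOLUTION pair (`…Defs.IsSubSwirl`: off the axis
`∂ₜF ≤ G₀ + (A/√(τ'−s))∂ᵣF`, `G₀ = ΔF − DF[V] − (2/r)∂ᵣF = swirlEqnIntegrand F V`) the tested, time-integrated equation
becomes an INEQUALITY in the favourable direction (`φ ≥ 0`):

* `slice_identity` — `∫ (F − M)(Dφ[V] + Δφ) + ∫ (2/r) F Dφ[e_r] = ∫ G₀ φ` on a slice (pure integration by parts; the
  tree's / g3's `slice_identity` verbatim for the new structure);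
* `integral_source_slice` — the one-sided source integrand `(A/√(τ'−s)) ∂ᵣF φ` is integrable on a slice and non-negative;
* `time_inequality` — on a line off the axis, `∫₀ᵀ (F − M) ∂ₛφ ds ≥ −∫₀ᵀ (G₀ + (A/√(τ'−s))∂ᵣF) φ ds` (integration by
  parts in time for the `C¹` function `F(·,y)`, then `∂ₛF φ ≤ (G₀ + src) φ`).

Seat ns-hsw-p1 g5 (LEAD of 25311, cell pub-ns-dss).  WHAT THIS IS NOT: not a statement about Navier–Stokes regularity (Clay A); a
linear parabolic tool about HYPOTHETICAL blow-up profiles; helper `--supports` 25311.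
-/

noncomputable section

-- the summit and its single sub-problem share the name (CONVENTIONS §1), as in every Theorems file
set_option linter.dupNamespace false

namespace Summit.NavierStokesRegularity.NavierStokesRegularity.Theorems.HalfSpaceWindowDoorCirculationCarryingRigiditySubSwirlSpaceTime

open MeasureTheory Set Function Filter Topology TopologicalSpace InnerProductSpace WithLp Metric
open scoped Laplacian RealInnerProductSpace ContDiff
open Literature.Analysis Literature.Analysis.FluidPDE
open Summit.NavierStokesRegularity.NavierStokesRegularity.Theorems.HalfSpaceWindowDoorCirculationCarryingRigidityDefs
open Summit.NavierStokesRegularity.NavierStokesRegularity.Theorems.HalfSpaceWindowDoorCirculationCarryingRigiditySubSwirl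
open Summit.NavierStokesRegularity.NavierStokesRegularity.Theorems.HalfSpaceWindowDoorCirculationCarryingRigiditySubSwirl.IsSubSwirl

namespace IsSubSwirl

variable {Cf Cu Cg A τ' : ℝ} {F : ℝ → (EuclideanSpace ℝ (Fin 3)) → ℝ}
  {V : ℝ → (EuclideanSpace ℝ (Fin 3)) → (EuclideanSpace ℝ (Fin 3))}

/-! ### The slice identity -/

/-- **The slice identity** (tree `IsKNSSSwirlPair.slice_identity`, g3 `IsSourcedSwirl.slice_identity`; no equation involved —
Green, the divergence-free IBP and the axis integration by parts):
`∫ (F − M)(Dφ[V] + Δφ) + ∫ (2/r) F Dφ[e_r] = ∫ (ΔF − DF[V] − (2/r)∂ᵣF) φ`. -/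
theorem slice_identity (hP : IsSubSwirl Cf Cu Cg A τ' F V) {s : ℝ} (hs : s < τ') (L T M : ℝ) :
    (∫ y, (F s y - M) * (fderiv ℝ (phiCut L T s) y (V s y) + (Δ (phiCut L T s)) y)) +
      ∫ y, 2 / cylRadius y * (F s y * fderiv ℝ (phiCut L T s) y (eR y)) =
    ∫ y, ((Δ (F s)) y - fderiv ℝ (F s) y (V s y) -
      2 / cylRadius y * partialDeriv (eR y) (F s) y) * phiCut L T s y := by
  set φ := phiCut L T s with hφ
  have hφs : ContDiff ℝ 2 φ := contDiff_phiCut L T s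
  have hφc : HasCompactSupport φ := hasCompactSupport_phiCut L T s
  have hF2 : ContDiff ℝ 2 (F s) := (hP.smooth s hs).of_le (by norm_cast)
  have hF1 : ContDiff ℝ 1 (F s) := (hP.smooth s hs).of_le (by norm_cast)
  have hV1 : ContDiff ℝ 1 (V s) := (hP.smooth_drift s hs).of_le (by norm_cast)
  have hcF : Continuous (F s) := hF1.continuous
  have hcFM : Continuous fun y => F s y - M := hcF.sub continuous_const
  have hcDφV : Continuous fun y => fderiv ℝ φ y (V s y) :=
    (hφs.continuous_fderiv (by norm_num)).clm_apply hV1.continuous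
  have hcΔφ : Continuous (Δ φ) := continuous_laplacian hφs
  have hcΔF : Continuous (Δ (F s)) := continuous_laplacian hF2
  have hcDFV : Continuous fun y => fderiv ℝ (F s) y (V s y) :=
    (hF1.continuous_fderiv one_ne_zero).clm_apply hV1.continuous
  have hcφ : Continuous φ := hφs.continuous
  have hi1 : Integrable fun y => (F s y - M) * fderiv ℝ φ y (V s y) :=
    (hcFM.mul hcDφV).integrable_of_hasCompactSupport
      (HasCompactSupport.fderiv_apply_fun hφc (V s)).mul_left
  have hi2 : Integrable fun y => (F s y - M) * (Δ φ) y :=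
    (hcFM.mul hcΔφ).integrable_of_hasCompactSupport (HasCompactSupport.laplacian_fun hφc).mul_left
  have hi3 : Integrable fun y => (Δ (F s)) y * φ y :=
    (hcΔF.mul hcφ).integrable_of_hasCompactSupport hφc.mul_left
  have hi4 : Integrable fun y => fderiv ℝ (F s) y (V s y) * φ y :=
    (hcDFV.mul hcφ).integrable_of_hasCompactSupport hφc.mul_left
  obtain ⟨hi5, hi6, haxis⟩ := integrable_and_integral_two_div_cylRadius_mul_fderiv_eR hF1
    (hφs.of_le (by norm_num)) hφc (hP.axisymmetric s hs) (isAxisymmetricScalar_phiCut L T s)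
    (hP.axis s hs)
  have hconv := integral_sub_const_mul_fderiv_apply_eq hV1 (hP.divFree s hs) hF1
    (hφs.of_le (by norm_num)) hφc M
  have hgreen := integral_sub_const_mul_laplacian_eq hF2 hφs hφc M
  have hL : ∫ y, (F s y - M) * (fderiv ℝ φ y (V s y) + (Δ φ) y) =
      (∫ y, (F s y - M) * fderiv ℝ φ y (V s y)) + ∫ y, (F s y - M) * (Δ φ) y := by
    rw [← integral_add hi1 hi2]
    exact integral_congr_ae (Eventually.of_forall fun y => by ring)
  have hi34 : Integrable fun y => (Δ (F s)) y * φ y - fderiv ℝ (F s) y (V s y) * φ y :=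
    hi3.sub hi4
  have hR : ∫ y, ((Δ (F s)) y - fderiv ℝ (F s) y (V s y) -
      2 / cylRadius y * partialDeriv (eR y) (F s) y) * φ y =
      (∫ y, (Δ (F s)) y * φ y) - (∫ y, fderiv ℝ (F s) y (V s y) * φ y) -
        ∫ y, 2 / cylRadius y * (fderiv ℝ (F s) y (eR y) * φ y) := by
    rw [← integral_sub hi3 hi4, ← integral_sub hi34 hi5]
    refine integral_congr_ae (Eventually.of_forall fun y => ?_)
    simp only [partialDeriv_apply]
    ring
  rw [hL, hR, hconv, hgreen, haxis]
  ring

/-! ### The one-sided source on a slice -/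

/-- On a slice `s < τ'` the source integrand `(A/√(τ'−s)) ∂ᵣF φ` is integrable (continuous with compact support) and
NON-NEGATIVE (`A ≥ 0`, `∂ᵣF ≥ 0`, `φ ≥ 0`), `G₀ φ` is integrable, and
`∫ (G₀ + (A/√(τ'−s))∂ᵣF) φ = ∫ G₀ φ + ∫ (A/√(τ'−s)) ∂ᵣF φ`, `G₀ = swirlEqnIntegrand F V`. -/
theorem integral_source_slice (hP : IsSubSwirl Cf Cu Cg A τ' F V) {s : ℝ} (hs : s < τ') (L T : ℝ) :
    Integrable (fun y => A / Real.sqrt (τ' - s) * fderiv ℝ (F s) y (eR y) * phiCut L T s y) ∧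
    Integrable (fun y => swirlEqnIntegrand F V s y * phiCut L T s y) ∧
    (∀ y, 0 ≤ A / Real.sqrt (τ' - s) * fderiv ℝ (F s) y (eR y) * phiCut L T s y) ∧
    ∫ y, (swirlEqnIntegrand F V s y + A / Real.sqrt (τ' - s) * fderiv ℝ (F s) y (eR y)) * phiCut L T s y =
      (∫ y, swirlEqnIntegrand F V s y * phiCut L T s y) +
        ∫ y, A / Real.sqrt (τ' - s) * fderiv ℝ (F s) y (eR y) * phiCut L T s y := by
  set φ := phiCut L T s with hφ
  have hφs : ContDiff ℝ 2 φ := contDiff_phiCut L T s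
  have hφc : HasCompactSupport φ := hasCompactSupport_phiCut L T s
  have hF2 : ContDiff ℝ 2 (F s) := (hP.smooth s hs).of_le (by norm_cast)
  have hF1 : ContDiff ℝ 1 (F s) := (hP.smooth s hs).of_le (by norm_cast)
  have hV1 : ContDiff ℝ 1 (V s) := (hP.smooth_drift s hs).of_le (by norm_cast)
  have hcφ : Continuous φ := hφs.continuous
  have hcΔF : Continuous (Δ (F s)) := continuous_laplacian hF2
  have hcDF : Continuous (fderiv ℝ (F s)) := hF1.continuous_fderiv one_ne_zero
  have hcDFV : Continuous fun y => fderiv ℝ (F s) y (V s y) := hcDF.clm_apply hV1.continuous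
  have hi3 : Integrable fun y => (Δ (F s)) y * φ y :=
    (hcΔF.mul hcφ).integrable_of_hasCompactSupport hφc.mul_left
  have hi4 : Integrable fun y => fderiv ℝ (F s) y (V s y) * φ y :=
    (hcDFV.mul hcφ).integrable_of_hasCompactSupport hφc.mul_left
  have hi5 : Integrable fun y => 2 / cylRadius y * (fderiv ℝ (F s) y (eR y) * φ y) :=
    integrable_two_div_cylRadius_mul_fderiv_eR_mul hF1 (contDiff_phiCut L T s) hφc (hP.axisymmetric s hs)
      (isAxisymmetricScalar_phiCut L T s) (hP.axis s hs)
  have hG0 : Integrable fun y => swirlEqnIntegrand F V s y * φ y := by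
    have : Integrable fun y => (Δ (F s)) y * φ y - fderiv ℝ (F s) y (V s y) * φ y -
        2 / cylRadius y * (fderiv ℝ (F s) y (eR y) * φ y) := (hi3.sub hi4).sub hi5
    refine this.congr (Eventually.of_forall fun y => ?_)
    simp only [swirlEqnIntegrand, partialDeriv_apply]
    ring
  -- the source integrand: measurable, and dominated by `(A/√(τ'−s)) ‖∇F‖_∞ |φ|` on the cylinder carrying `φ`
  obtain ⟨K₀, hK₀⟩ := (isCompact_solidCylinder 2 L).exists_bound_of_continuousOn hcDF.continuousOn
  set K : ℝ := max K₀ 0 with hKdef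
  have hK : ∀ y ∈ solidCylinder 2 L, ‖fderiv ℝ (F s) y‖ ≤ K := fun y hy => (hK₀ y hy).trans (le_max_left _ _)
  have hK0 : 0 ≤ K := le_max_right _ _
  have hA := hP.A_nonneg
  have hAs : 0 ≤ A / Real.sqrt (τ' - s) := div_nonneg hA (Real.sqrt_nonneg _)
  have happly : Continuous fun q : ((EuclideanSpace ℝ (Fin 3)) →L[ℝ] ℝ) × (EuclideanSpace ℝ (Fin 3)) => q.1 q.2 :=
    (isBoundedBilinearMap_apply (𝕜 := ℝ) (E := EuclideanSpace ℝ (Fin 3)) (F := ℝ)).continuous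
  have hDm : Measurable fun y => fderiv ℝ (F s) y (eR y) :=
    happly.measurable.comp (hcDF.measurable.prodMk measurable_eR)
  have hmsrc : AEStronglyMeasurable (fun y => A / Real.sqrt (τ' - s) * fderiv ℝ (F s) y (eR y) * φ y) volume :=
    ((measurable_const.mul hDm).mul hcφ.measurable).aestronglyMeasurable
  have hdom : Integrable fun y => A / Real.sqrt (τ' - s) * K * |φ y| :=
    ((hcφ.abs).integrable_of_hasCompactSupport hφc.abs).const_mul _
  have hsrc : Integrable fun y => A / Real.sqrt (τ' - s) * fderiv ℝ (F s) y (eR y) * φ y := by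
    refine hdom.mono' hmsrc (Eventually.of_forall fun y => ?_)
    by_cases hy : y ∈ solidCylinder 2 L
    · have hD : |fderiv ℝ (F s) y (eR y)| ≤ K := by
        rw [← Real.norm_eq_abs]
        exact ((fderiv ℝ (F s) y).le_opNorm _).trans
          ((mul_le_of_le_one_right (norm_nonneg _) (norm_eR_le_one _)).trans (hK y hy))
      rw [Real.norm_eq_abs, abs_mul, abs_mul, abs_of_nonneg hAs]
      exact mul_le_mul_of_nonneg_right (mul_le_mul_of_nonneg_left hD hAs) (abs_nonneg _)
    · have h0 : φ y = 0 := by rw [hφ]; exact (phiCut_derivs_eq_zero_of_not_mem (T := T) (s := s) hy).1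
      rw [h0]; simp
  have hnn : ∀ y, 0 ≤ A / Real.sqrt (τ' - s) * fderiv ℝ (F s) y (eR y) * φ y := fun y =>
    mul_nonneg (mul_nonneg (div_nonneg hP.A_nonneg (Real.sqrt_nonneg _)) (hP.radial_nonneg s hs y))
      (phiCut_mem_Icc L T s y).1
  refine ⟨hsrc, hG0, hnn, ?_⟩
  rw [← integral_add hG0 hsrc]
  exact integral_congr_ae (Eventually.of_forall fun y => by ring)

/-! ### The time inequality on a line off the axis -/

/-- The time slice `s ↦ F(s,y)` has a continuous derivative on `(−∞, τ')`. -/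
theorem continuousOn_deriv_time (hP : IsSubSwirl Cf Cu Cg A τ' F V) (y : EuclideanSpace ℝ (Fin 3)) :
    ContinuousOn (fun s => deriv (fun σ => F σ y) s) (Iio τ') := by
  have h := contDiffOn_time hP y
  have h1 : ContDiffOn ℝ 1 (fun t => F t y) (Iio τ') := h.of_le (by norm_cast)
  exact ((contDiffOn_succ_iff_deriv_of_isOpen (n := 0) isOpen_Iio).1 h1).2.2.continuousOn

/-- **The time inequality on a line off the axis** (KNSS (5.15)/(5.17) for a SUBSOLUTION): for `0 ≤ T < τ'`, `y` off the axis
and any constant `M`,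
`∫₀ᵀ (F(s,y) − M) ∂ₛφ(s,y) ds ≥ −∫₀ᵀ (G₀(s,y) + (A/√(τ'−s)) ∂ᵣF(s,y)) φ(s,y) ds`, `G₀ = swirlEqnIntegrand F V`.
(Integration by parts in time — `F(·,y)` is `C¹`, `φ(0,·) = φ(T,·) = 0` — then `∂ₛF φ ≤ (G₀ + src) φ` from `sub_time`
and `φ ≥ 0`.) -/
theorem time_inequality (hP : IsSubSwirl Cf Cu Cg A τ' F V) {L T : ℝ} (hT0 : 0 ≤ T)
    (hTτ : T < τ') (M : ℝ) {y : (EuclideanSpace ℝ (Fin 3))} (hy : cylRadius y ≠ 0) :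
    -∫ s in (0 : ℝ)..T, (swirlEqnIntegrand F V s y + A / Real.sqrt (τ' - s) * fderiv ℝ (F s) y (eR y)) *
        phiCut L T s y ≤
      ∫ s in (0 : ℝ)..T, (F s y - M) * (psiCut L y * deriv (zetaCut T) s) := by
  have hτ : ∀ s ∈ Icc (0 : ℝ) T, s < τ' := fun s hs => lt_of_le_of_lt hs.2 hTτ
  have hslab : MapsTo (fun s : ℝ => ((s, y) : ℝ × (EuclideanSpace ℝ (Fin 3)))) (Icc 0 T) (Iio τ' ×ˢ univ) :=
    fun s hs => ⟨hτ s hs, mem_univ _⟩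
  have hcs : Continuous fun s : ℝ => ((s, y) : ℝ × (EuclideanSpace ℝ (Fin 3))) := by fun_prop
  -- continuity in `s` of the ingredients of `G₀` on `[0, T]`
  have hA' : ContinuousOn (fun s => (Δ (F s)) y) (Icc 0 T) := by
    have h := hP.continuousOn_laplacian.comp hcs.continuousOn hslab
    simpa only [Function.comp_def] using h
  have hBc : ContinuousOn (fun s => fderiv ℝ (F s) y) (Icc 0 T) := by
    have h := hP.continuousOn_fderiv.comp hcs.continuousOn hslab
    simpa only [Function.comp_def] using h
  have hVc : ContinuousOn (fun s => V s y) (Icc 0 T) :=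
    hP.smooth_drift_joint.continuousOn.comp hcs.continuousOn hslab
  have hsqrt : ContinuousOn (fun s => A / Real.sqrt (τ' - s)) (Icc 0 T) := by
    refine continuousOn_const.div (by fun_prop) fun s hs => ?_
    exact (Real.sqrt_pos.2 (by linarith [hs.2])).ne'
  have hGc : ContinuousOn (fun s => (swirlEqnIntegrand F V s y + A / Real.sqrt (τ' - s) * fderiv ℝ (F s) y (eR y)) *
      phiCut L T s y) (Icc 0 T) := by
    have h1 : ContinuousOn (fun s => fderiv ℝ (F s) y (V s y)) (Icc 0 T) := by
      have happly : Continuous fun q : ((EuclideanSpace ℝ (Fin 3)) →L[ℝ] ℝ) × (EuclideanSpace ℝ (Fin 3)) => q.1 q.2 :=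
        (isBoundedBilinearMap_apply (𝕜 := ℝ) (E := EuclideanSpace ℝ (Fin 3)) (F := ℝ)).continuous
      exact happly.comp_continuousOn (hBc.prodMk hVc)
    have h2 : ContinuousOn (fun s => fderiv ℝ (F s) y (eR y)) (Icc 0 T) := hBc.clm_apply continuousOn_const
    have hφ : Continuous fun s => phiCut L T s y :=
      show Continuous fun s => psiCut L y * zetaCut T s from continuous_const.mul (continuous_zetaCut T)
    have h : ContinuousOn (fun s => ((Δ (F s)) y - fderiv ℝ (F s) y (V s y) - 2 / cylRadius y * fderiv ℝ (F s) y (eR y) +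
        A / Real.sqrt (τ' - s) * fderiv ℝ (F s) y (eR y)) * phiCut L T s y) (Icc 0 T) :=
      (((hA'.sub h1).sub (continuousOn_const.mul h2)).add (hsqrt.mul h2)).mul hφ.continuousOn
    simpa only [swirlEqnIntegrand, partialDeriv_apply] using h
  -- the derivative of `F(·,y)` and the integration by parts
  have hderc : ContinuousOn (fun s => deriv (fun σ => F σ y) s) (Icc 0 T) :=
    (continuousOn_deriv_time hP y).mono fun s hs => hτ s hs
  have hu : ∀ s ∈ uIcc (0 : ℝ) T, HasDerivAt (fun σ => F σ y - M) (deriv (fun σ => F σ y) s) s := by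
    intro s hs
    rw [uIcc_of_le hT0] at hs
    exact (hasDerivAt_time hP (hτ s hs) y).sub_const M
  have hv : ∀ s ∈ uIcc (0 : ℝ) T, HasDerivAt (fun σ => phiCut L T σ y) (psiCut L y * deriv (zetaCut T) s) s :=
    fun s _ => hasDerivAt_phiCut L T s y
  have hu' : IntervalIntegrable (fun s => deriv (fun σ => F σ y) s) volume 0 T := by
    rw [intervalIntegrable_iff_integrableOn_Icc_of_le hT0]
    exact hderc.integrableOn_compact isCompact_Icc
  have hv' : IntervalIntegrable (fun s => psiCut L y * deriv (zetaCut T) s) volume 0 T :=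
    (continuous_const.mul (continuous_deriv_zetaCut T)).intervalIntegrable _ _
  have hψ0 : phiCut L T 0 y = 0 := phiCut_eq_zero_of_not_mem_Ioo (fun h => by linarith [h.1]) y
  have hψT : phiCut L T T y = 0 := phiCut_eq_zero_of_not_mem_Ioo (fun h => lt_irrefl _ h.2) y
  have hIBP := intervalIntegral.integral_mul_deriv_eq_deriv_mul hu hv hu' hv'
  rw [hψ0, hψT, mul_zero, mul_zero, sub_zero, zero_sub] at hIBP
  rw [hIBP, neg_le_neg_iff]
  -- `∫ ∂ₛF φ ≤ ∫ (G₀ + src) φ`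
  have hφc : Continuous fun s => phiCut L T s y :=
    show Continuous fun s => psiCut L y * zetaCut T s from continuous_const.mul (continuous_zetaCut T)
  have hi1 : IntervalIntegrable (fun s => deriv (fun σ => F σ y) s * phiCut L T s y) volume 0 T := by
    rw [intervalIntegrable_iff_integrableOn_Icc_of_le hT0]
    exact (hderc.mul hφc.continuousOn).integrableOn_compact isCompact_Icc
  have hi2 : IntervalIntegrable (fun s => (swirlEqnIntegrand F V s y + A / Real.sqrt (τ' - s) *
      fderiv ℝ (F s) y (eR y)) * phiCut L T s y) volume 0 T := by
    rw [intervalIntegrable_iff_integrableOn_Icc_of_le hT0]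
    exact hGc.integrableOn_compact isCompact_Icc
  refine intervalIntegral.integral_mono_on hT0 hi1 hi2 fun s hs => ?_
  have hsub := hP.sub_time s (hτ s hs) y hy
  have hφ0 : 0 ≤ phiCut L T s y := (phiCut_mem_Icc L T s y).1
  have e : swirlEqnIntegrand F V s y + A / Real.sqrt (τ' - s) * fderiv ℝ (F s) y (eR y) =
      (Δ (F s)) y - fderiv ℝ (F s) y (V s y) - 2 / cylRadius y * partialDeriv (eR y) (F s) y +
        A / Real.sqrt (τ' - s) * partialDeriv (eR y) (F s) y := by
    simp only [swirlEqnIntegrand, partialDeriv_apply]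
  rw [e]
  exact mul_le_mul_of_nonneg_right hsub hφ0

end IsSubSwirl

end Summit.NavierStokesRegularity.NavierStokesRegularity.Theorems.HalfSpaceWindowDoorCirculationCarryingRigiditySubSwirlSpaceTime

end
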